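import Mathlib
import HarnessLib
import Summits.ResolutionOfSingularities.ResolutionOfSingularities.Theorems.WildQuotientsWildQuotientResolutionTerminalBlowupChartPackage
import Summits.ResolutionOfSingularities.ResolutionOfSingularities.Theorems.WildQuotientsWildQuotientResolutionTerminalBlowupSpec
import Summits.ResolutionOfSingularities.ResolutionOfSingularities.Theorems.WildQuotientsWildQuotientResolutionJordanThreeChartAlgebra
import Summits.ResolutionOfSingularities.ResolutionOfSingularities.Theorems.WildQuotientsWildQuotientResolutionJordanThreeK3ChartAlgebra
import Summits.ResolutionOfSingularities.ResolutionOfSingularities.Theorems.WildQuotientsWildQuotientResolutionJordanFiveCentre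
import Summits.ResolutionOfSingularities.ResolutionOfSingularities.Theorems.WildQuotientsWildQuotientResolutionJordanFiveChartDAug
import Summits.ResolutionOfSingularities.ResolutionOfSingularities.Theorems.WildQuotientsWildQuotientResolutionJordanFiveFrameDefs
import Summits.ResolutionOfSingularities.ResolutionOfSingularities.Theorems.WildQuotientsWildQuotientResolutionBlowupChartStalk
import Literature.AlgebraicGeometry.Resolution.AffineBlowupIntegral

/-!
# RUNG V5 brick B8 (divisorial half): the divisorial clause over the terminal chart `D₊(x_d¹² t)`
# of `Bl_{I₁₂} 𝔸ⁿ`, every `p ≥ 5`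

(crux stmt-ResolutionOfSingularities-15640 `WildQuotients.WildQuotientResolution`, line `Sketch`;
chain w45c NEXT RUNG R-T / RUNG V5, binder `HdivD` of res-L1-w45c-lead-1's scaffold
`JordanFive.jordanFive_hasResolution_of_bricks` (`L/res-L1-w45c-lead-1/stubs/J5Bricks.lean` l.72–86;
plan-1 RULING 2026-08-27T10:54:44Z: B8 = res-L1-w45c-stub-3); stub-4's
`JordanFour.I6.isPrincipal_stalkAug_liftAction_of_mem` (p493991) followed VERBATIM with `Fin 40`,
the `J₅` law and the generator vector `JordanFive.gens12`. [OURS · L1 W4.5c] — NOT a statement of any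
manuscript; replaces the role of no printed item.)

For the `J₅` datum (`σ x_b = x_b + x_a`, …, `σ x_e = x_e + x_d`, identity elsewhere) over a field of
characteristic `p ≥ 5`, `K = gens12` the 40 generators of `I₁₂`, `ρ g = Spec (g⁻¹)`, `π : V → 𝔸ⁿ`
ANY blow-up along `Ĩ₁₂` with `Ĩ₁₂` `ρ`-stable and `V` integral: for every `g ∈ ⟨σ⟩` and every point `v`
fixed by the lift AT WHICH every `K l` is a multiple of `x_d¹²` in `𝒪_{V,v}` (every point over the
terminal chart), the stalk augmentation ideal `⟨(liftAction ρ g)^♯_v y − y⟩` is principal — it is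
`(x_d)`: the `J₅` augmentation ideal on `k[x]` is `(x_a, x_b, x_c, x_d)`
(`JordanFive.span_smul_sub_eq_centre_prime`), and in any Rees chart over the terminal chart
`(x_a, x_b, x_c, x_d) + (g U_l − U_l) = (x_d)` (`JordanFive.I12.chart_isPrincipal`). This is the K–L
input making the terminal quotient piece `O₃/G` regular (`JordanFive.I12.isPrincipal_stalkAug_liftAction_of_mem`).
-/

-- single-problem summit: the doubled namespace component `ResolutionOfSingularities` is forced
set_option linter.dupNamespace false

noncomputable section

open CategoryTheory AlgebraicGeometry TopologicalSpace IsLocalRing MvPolynomial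
open Literature.AlgebraicGeometry.Resolution
open scoped Pointwise

namespace Summit.ResolutionOfSingularities.ResolutionOfSingularities.Theorems.WildQuotientResolution.JordanFive

-- the stalk / Rees-chart unifications of this assembly are individually cheap but numerous
set_option maxHeartbeats 1600000 in
/-- **The divisorial clause over the terminal chart of `Bl_{I₁₂} 𝔸ⁿ`, every `p ≥ 5`** (see the
module docstring). [OURS · L1 W4.5c] [folklore; assembly of landed decls] -/
theorem I12.isPrincipal_stalkAug_liftAction_of_mem (p : ℕ) (hp : p.Prime) (hp5 : 5 ≤ p)
    (k : Type) [Field k] [CharP k p] (n : ℕ)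
    (σ : MvPolynomial (Fin n) k ≃ₐ[k] MvPolynomial (Fin n) k) (a b c d e : Fin n)
    (hab : a ≠ b) (hac : a ≠ c) (had : a ≠ d) (hae : a ≠ e)
    (hb : σ (X b) = X b + X a) (hc : σ (X c) = X c + X b) (hd : σ (X d) = X d + X c)
    (he : σ (X e) = X e + X d)
    (hσ : ∀ i, i ≠ b → i ≠ c → i ≠ d → i ≠ e → σ (X i) = X i)
    (K : Fin 40 → MvPolynomial (Fin n) k) (hK : K = gens12 k n a b c d)
    (ρ : ↥(Subgroup.zpowers σ) →* Aut (Spec (CommRingCat.of (MvPolynomial (Fin n) k))))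
    (hρ : ∀ g : ↥(Subgroup.zpowers σ), (ρ g).hom = Spec.map (CommRingCat.ofHom
      ((MulSemiringAction.toRingEquiv (↥(Subgroup.zpowers σ)) (MvPolynomial (Fin n) k) g⁻¹ :
        MvPolynomial (Fin n) k ≃+* MvPolynomial (Fin n) k) :
          MvPolynomial (Fin n) k →+* MvPolynomial (Fin n) k)))
    {V : Scheme.{0}} {π : V ⟶ Spec (CommRingCat.of (MvPolynomial (Fin n) k))} [IsIntegral V]
    (hπ : IsBlowup π (affineBlowup.idealSheaf (I12 k n a b c d)))
    (hJ : ∀ g : ↥(Subgroup.zpowers σ),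
      (affineBlowup.idealSheaf (I12 k n a b c d)).comap (ρ g).hom =
        affineBlowup.idealSheaf (I12 k n a b c d))
    (g : ↥(Subgroup.zpowers σ)) (v : V) (hv : ((hπ.liftAction ρ hJ) g).hom.base v = v)
    (hmem : ∀ l, (π.stalkMap v).hom
        (((Scheme.ΓSpecIso (CommRingCat.of (MvPolynomial (Fin n) k))).inv ≫
          (Spec (CommRingCat.of (MvPolynomial (Fin n) k))).presheaf.germ ⊤ (π.base v) trivial).hom
            (K l)) ∈ Ideal.span {(π.stalkMap v).hom
        (((Scheme.ΓSpecIso (CommRingCat.of (MvPolynomial (Fin n) k))).inv ≫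
          (Spec (CommRingCat.of (MvPolynomial (Fin n) k))).presheaf.germ ⊤ (π.base v) trivial).hom
            (X d)) ^ 12}) :
    (Ideal.span (Set.range fun y =>
      (V.presheaf.stalkSpecializes (specializes_of_eq hv) ≫
        ((hπ.liftAction ρ hJ) g).hom.stalkMap v).hom y - y)).IsPrincipal := by
  classical
  -- the germ map `k[x] → 𝒪_{𝔸ⁿ, π v}` and the action of `g⁻¹` on `k[x]`
  obtain ⟨γ, hγdef⟩ : ∃ γ : (MvPolynomial (Fin n) k) →+*
      (Spec (CommRingCat.of (MvPolynomial (Fin n) k))).presheaf.stalk (π.base v),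
      γ = ((Scheme.ΓSpecIso (CommRingCat.of (MvPolynomial (Fin n) k))).inv ≫
        (Spec (CommRingCat.of (MvPolynomial (Fin n) k))).presheaf.germ ⊤ (π.base v) trivial).hom :=
    ⟨_, rfl⟩
  rw [← hγdef] at hmem
  set φ : (MvPolynomial (Fin n) k) →+* (MvPolynomial (Fin n) k) :=
    ((MulSemiringAction.toRingEquiv _ (MvPolynomial (Fin n) k) g⁻¹ :
      (MvPolynomial (Fin n) k) ≃+* (MvPolynomial (Fin n) k)) :
        (MvPolynomial (Fin n) k) →+* (MvPolynomial (Fin n) k)) with hφ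
  have hφapp : ∀ F : (MvPolynomial (Fin n) k), φ F = g⁻¹ • F := fun F => rfl
  by_cases hg : g = 1
  · -- `g = 1`: the lift is the identity and the ideal is `⊥`
    have hρg : (ρ g).hom = 𝟙 _ := by
      rw [hρ]
      have : ((MulSemiringAction.toRingEquiv _ (MvPolynomial (Fin n) k) g⁻¹ :
          (MvPolynomial (Fin n) k) ≃+* (MvPolynomial (Fin n) k)) :
            (MvPolynomial (Fin n) k) →+* (MvPolynomial (Fin n) k)) = RingHom.id _ := by
        refine RingHom.ext fun F => ?_
        change (MulSemiringAction.toRingEquiv _ _ g⁻¹) F = F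
        rw [MulSemiringAction.toRingEquiv_apply_apply, hg, inv_one, one_smul]
      rw [this, CommRingCat.ofHom_id, Spec.map_id]
    have hlift : (hπ.liftAction ρ hJ g).hom = 𝟙 _ :=
      hπ.eq_id_of_comp_eq (by rw [hπ.liftAction_hom_comp, hρg, Category.comp_id])
    have key : ∀ (f : V ⟶ V) (_ : f = 𝟙 V) (hvf : f.base v = v),
        Ideal.span (Set.range fun s : V.presheaf.stalk v =>
          (V.presheaf.stalkSpecializes (specializes_of_eq hvf) ≫ f.stalkMap v).hom s - s) = ⊥ := by
      intro f hf hvf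
      subst hf
      refine Ideal.span_eq_bot.mpr ?_
      rintro _ ⟨s, rfl⟩
      change ((𝟙 V : V ⟶ V).stalkMap v).hom
        ((V.presheaf.stalkSpecializes (specializes_of_eq hvf)).hom s) - s = 0
      erw [Scheme.Hom.stalkMap_id]
      rw [sub_eq_zero]
      exact stalkSpecializes_self_apply V.presheaf v _ s
    rw [key _ hlift hv]
    exact bot_isPrincipal
  -- `g ≠ 1`: `g⁻¹ = σᵐ` with `m` a unit in `k`
  have hg' : g⁻¹ ≠ 1 := fun h => hg (inv_eq_one.mp h)
  obtain ⟨m, hmk, hm⟩ := exists_natCast_ne_zero_and_pow_eq k n σ p hp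
    (pow_prime_eq_one k n σ a b c d e hab hac had hae hb hc hd he hσ p hp hp5) g⁻¹ hg'
  have hgXa : g⁻¹ • (X a : (MvPolynomial (Fin n) k)) = X a := by
    change ((g⁻¹ : Subgroup.zpowers σ) : (MvPolynomial (Fin n) k) ≃ₐ[k] (MvPolynomial (Fin n) k))
      (X a) = X a
    rw [← hm]
    exact pow_apply_X_of_ne k n σ b c d e hσ m a hab hac had hae
  have hgXb : g⁻¹ • (X b : (MvPolynomial (Fin n) k)) = X b + (m : (MvPolynomial (Fin n) k)) * X a := by
    change ((g⁻¹ : Subgroup.zpowers σ) : (MvPolynomial (Fin n) k) ≃ₐ[k] (MvPolynomial (Fin n) k))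
      (X b) = _
    rw [← hm]
    exact pow_apply_X_b k n σ a b c d e hab hac had hae hb hσ m
  have hgXc : g⁻¹ • (X c : (MvPolynomial (Fin n) k)) = X c + (m : (MvPolynomial (Fin n) k)) * X b +
      ((m.choose 2 : ℕ) : MvPolynomial (Fin n) k) * X a := by
    change ((g⁻¹ : Subgroup.zpowers σ) : (MvPolynomial (Fin n) k) ≃ₐ[k] (MvPolynomial (Fin n) k))
      (X c) = _
    rw [← hm]
    exact pow_apply_X_c k n σ a b c d e hab hac had hae hb hc hσ m
  have hgXd : g⁻¹ • (X d : (MvPolynomial (Fin n) k)) = X d + (m : (MvPolynomial (Fin n) k)) * X c +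
      ((m.choose 2 : ℕ) : MvPolynomial (Fin n) k) * X b +
      ((m.choose 3 : ℕ) : MvPolynomial (Fin n) k) * X a := by
    change ((g⁻¹ : Subgroup.zpowers σ) : (MvPolynomial (Fin n) k) ≃ₐ[k] (MvPolynomial (Fin n) k))
      (X d) = _
    rw [← hm]
    exact pow_apply_X_d k n σ a b c d e hab hac had hae hb hc hd hσ m
  have hcK : Ideal.span (Set.range fun l => γ (K l)) =
      stalkIdeal (affineBlowup.idealSheaf (I12 k n a b c d)) (π.base v) := by
    rw [stalkIdeal_eq_map_germ (affineBlowup.idealSheaf (I12 k n a b c d))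
      ⟨⊤, isAffineOpen_top (Spec (CommRingCat.of (MvPolynomial (Fin n) k)))⟩ trivial]
    change _ = Ideal.map _ ((Scheme.IdealSheafData.ofIdealTop _).ideal
      ⟨⊤, isAffineOpen_top (Spec (CommRingCat.of (MvPolynomial (Fin n) k)))⟩)
    rw [ideal_ofIdealTop_top, Ideal.map_map, I12, hK, Ideal.map_span, ← Set.range_comp, hγdef]
    rfl
  refine TerminalBlowup.stalkAug_of_chartPackage hπ (hπ.liftAction_hom_comp ρ hJ g) v hv
    (fun l => γ (K l)) hcK (fun I => I.IsPrincipal) ?_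
  intro hs j 𝔴 χ hχ hloc hmax hab'
  set aH := V.presheaf.stalkSpecializes (specializes_of_eq hv) ≫
    ((hπ.liftAction ρ hJ) g).hom.stalkMap v with haH
  set bH := (Spec (CommRingCat.of (MvPolynomial (Fin n) k))).presheaf.stalkSpecializes
    (specializes_of_eq hs) ≫ (ρ g).hom.stalkMap (π.base v) with hbH
  have key : ∀ (f : Spec (CommRingCat.of (MvPolynomial (Fin n) k)) ⟶
      Spec (CommRingCat.of (MvPolynomial (Fin n) k)))
      (_ : f = Spec.map (CommRingCat.ofHom φ)) (hsf : f.base (π.base v) = π.base v)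
      (F : (MvPolynomial (Fin n) k)),
      ((Spec (CommRingCat.of (MvPolynomial (Fin n) k))).presheaf.stalkSpecializes
        (specializes_of_eq hsf) ≫ f.stalkMap (π.base v)).hom (γ F) = γ (φ F) := by
    intro f hf hsf F
    subst hf
    rw [hγdef]
    exact TerminalBlowup.stalkAction_germ φ (π.base v) hsf F
  have hbγ : ∀ F : (MvPolynomial (Fin n) k), bH.hom (γ F) = γ (g⁻¹ • F) := fun F =>
    key _ (hρ g) hs F
  have hrel : ∀ l : Fin 40, (π.stalkMap v).hom (γ (K j)) * χ (chartGen (fun l => γ (K l)) j l) =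
      (π.stalkMap v).hom (γ (K l)) := fun l =>
    (congrArg (· * χ (chartGen (fun l => γ (K l)) j l)) (hχ (γ (K j))).symm).trans
      (((map_mul χ _ _).symm.trans
        (congrArg χ (reesChartBase_apply_eq_mul_chartGen (fun l => γ (K l)) j l)).symm).trans
          (hχ (γ (K l))))
  have hTnzd : (π.stalkMap v).hom (γ (K j)) ∈ nonZeroDivisors (V.presheaf.stalk v) := by
    letI := χ.toAlgebra
    haveI : IsLocalization 𝔴.asIdeal.primeCompl (V.presheaf.stalk v) := hloc
    have h := IsLocalization.nonZeroDivisors_le_comap 𝔴.asIdeal.primeCompl (V.presheaf.stalk v)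
      (reesChartBase_mem_nonZeroDivisors (γ (K j))
        (Ideal.mem_span_range_self (f := fun l => γ (K l)) (x := j)))
    have hA : algebraMap (chartRing (fun l => γ (K l)) j) (V.presheaf.stalk v) = χ :=
      RingHom.algebraMap_toAlgebra χ
    have e : algebraMap (chartRing (fun l => γ (K l)) j) (V.presheaf.stalk v)
        (chartBase (fun l => γ (K l)) j (γ (K j))) = (π.stalkMap v).hom (γ (K j)) :=
      (congrArg (fun f : chartRing (fun l => γ (K l)) j →+* V.presheaf.stalk v =>
        f (chartBase (fun l => γ (K l)) j (γ (K j)))) hA).trans (hχ (γ (K j)))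
    exact e ▸ (Submonoid.mem_comap.mp h)
  have haug : Ideal.span (Set.range fun y => aH.hom y - y) =
      (Ideal.span (Set.range fun r => bH.hom r - r)).map (π.stalkMap v).hom ⊔
        Ideal.span (Set.range fun l : {l : Fin 40 // l ≠ j} =>
          aH.hom (χ (chartGen (fun l => γ (K l)) j l.1)) - χ (chartGen (fun l => γ (K l)) j l.1)) := by
    letI := χ.toAlgebra
    haveI : IsLocalization 𝔴.asIdeal.primeCompl (V.presheaf.stalk v) := hloc
    have hA : algebraMap (chartRing (fun l => γ (K l)) j) (V.presheaf.stalk v) = χ :=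
      RingHom.algebraMap_toAlgebra χ
    have hχ' : ∀ r, algebraMap (chartRing (fun l => γ (K l)) j) (V.presheaf.stalk v)
        (chartBase (fun l => γ (K l)) j r) = (π.stalkMap v).hom r := fun r =>
      (congrArg (fun f : chartRing (fun l => γ (K l)) j →+* V.presheaf.stalk v =>
        f (chartBase (fun l => γ (K l)) j r)) hA).trans (hχ r)
    have h := JordanThree.span_sub_eq_map_sup_span_of_chart (chartBase (fun l => γ (K l)) j)
      (fun l : {l : Fin 40 // l ≠ j} => chartGen (fun l => γ (K l)) j l.1)
      (eval₂Hom_chartGen_surjective (fun l => γ (K l)) j) 𝔴.asIdeal.primeCompl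
      (π.stalkMap v).hom hχ' bH.hom aH.hom hab'
    rw [hA] at h
    exact h
  have haugb : Ideal.span (Set.range fun r => bH.hom r - r) =
      (Ideal.span ({X a, X b, X c, X d} : Set (MvPolynomial (Fin n) k))).map γ := by
    apply le_antisymm
    · -- `⊆`: check on `k[x]` (ring maps out of a localisation)
      have hagree : (Ideal.Quotient.mk ((Ideal.span ({X a, X b, X c, X d} :
            Set (MvPolynomial (Fin n) k))).map γ)).comp bH.hom =
          Ideal.Quotient.mk ((Ideal.span ({X a, X b, X c, X d} : Set (MvPolynomial (Fin n) k))).map γ) := by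
        letI : Algebra (MvPolynomial (Fin n) k)
            ((Spec (CommRingCat.of (MvPolynomial (Fin n) k))).presheaf.stalk (π.base v)) :=
          StructureSheaf.stalkAlgebra (↑(CommRingCat.of (MvPolynomial (Fin n) k))) (π.base v)
        haveI : IsLocalization.AtPrime
            ((Spec (CommRingCat.of (MvPolynomial (Fin n) k))).presheaf.stalk (π.base v))
            (π.base v).asIdeal :=
          StructureSheaf.IsLocalization.to_stalk (↑(CommRingCat.of (MvPolynomial (Fin n) k)))
            (π.base v)
        have halg : ∀ F : MvPolynomial (Fin n) k, algebraMap (MvPolynomial (Fin n) k)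
            ((Spec (CommRingCat.of (MvPolynomial (Fin n) k))).presheaf.stalk (π.base v)) F =
            γ F := fun F => by rw [hγdef]; rfl
        apply IsLocalization.ringHom_ext (π.base v).asIdeal.primeCompl
          (S := (Spec (CommRingCat.of (MvPolynomial (Fin n) k))).presheaf.stalk (π.base v))
        refine RingHom.ext fun F => ?_
        simp only [RingHom.comp_apply, halg]
        rw [hbγ, Ideal.Quotient.eq, ← map_sub]
        exact Ideal.mem_map_of_mem γ (smul_sub_mem_centre k n σ a b c d e hb hc hd he hσ g⁻¹ F)
      refine Ideal.span_le.mpr ?_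
      rintro _ ⟨r, rfl⟩
      have h := RingHom.congr_fun hagree r
      rw [RingHom.comp_apply, Ideal.Quotient.eq] at h
      exact h
    · -- `⊇`: `γ (g⁻¹ • F - F) = b (γ F) - γ F` and `(x_a, x_b, x_c) = ⟨g⁻¹ • F - F⟩`
      have e := congrArg (Ideal.map γ)
        (span_smul_sub_eq_centre_prime k n σ a b c d e hab hac had hae hb hc hd he hσ p hp hp5 g⁻¹ hg')
      rw [← e]
      refine Ideal.map_le_iff_le_comap.mpr (Ideal.span_le.mpr ?_)
      rintro _ ⟨F, rfl⟩
      rw [SetLike.mem_coe, Ideal.mem_comap, map_sub, ← hbγ]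
      exact Ideal.subset_span ⟨γ F, rfl⟩
  have hmapι : ((Ideal.span ({X a, X b, X c, X d} : Set (MvPolynomial (Fin n) k))).map γ).map
      (π.stalkMap v).hom =
      Ideal.span {(π.stalkMap v).hom (γ (X a)), (π.stalkMap v).hom (γ (X b)),
        (π.stalkMap v).hom (γ (X c)), (π.stalkMap v).hom (γ (X d))} := by
    rw [Ideal.map_map, Ideal.map_span, Set.image_insert_eq, Set.image_insert_eq, Set.image_insert_eq,
      Set.image_singleton]
    rfl
  have heq : Ideal.span (Set.range fun y => aH.hom y - y) =
      Ideal.span {(π.stalkMap v).hom (γ (X a)), (π.stalkMap v).hom (γ (X b)),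
        (π.stalkMap v).hom (γ (X c)), (π.stalkMap v).hom (γ (X d))} ⊔
        Ideal.span (Set.range fun l : {l : Fin 40 // l ≠ j} =>
          aH.hom (χ (chartGen (fun l => γ (K l)) j l.1)) - χ (chartGen (fun l => γ (K l)) j l.1)) :=
    haug.trans (congrArg₂ (· ⊔ ·)
      ((congrArg (Ideal.map (π.stalkMap v).hom) haugb).trans hmapι) rfl)
  rw [heq]
  have haXa : aH.hom ((π.stalkMap v).hom (γ (X a))) = (π.stalkMap v).hom (γ (X a)) := by
    rw [hab', hbγ, hgXa]
  have haXb : aH.hom ((π.stalkMap v).hom (γ (X b))) =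
      (π.stalkMap v).hom (γ (X b)) + (m : V.presheaf.stalk v) * (π.stalkMap v).hom (γ (X a)) := by
    rw [hab', hbγ, hgXb, map_add, map_mul, map_natCast, map_add, map_mul, map_natCast]
  have haXc : aH.hom ((π.stalkMap v).hom (γ (X c))) =
      (π.stalkMap v).hom (γ (X c)) + (m : V.presheaf.stalk v) * (π.stalkMap v).hom (γ (X b)) +
        ((m.choose 2 : ℕ) : V.presheaf.stalk v) * (π.stalkMap v).hom (γ (X a)) := by
    rw [hab', hbγ, hgXc, map_add, map_add, map_mul, map_mul, map_natCast, map_natCast, map_add,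
      map_add, map_mul, map_mul, map_natCast, map_natCast]
  have haXd : aH.hom ((π.stalkMap v).hom (γ (X d))) =
      (π.stalkMap v).hom (γ (X d)) + (m : V.presheaf.stalk v) * (π.stalkMap v).hom (γ (X c)) +
        ((m.choose 2 : ℕ) : V.presheaf.stalk v) * (π.stalkMap v).hom (γ (X b)) +
        ((m.choose 3 : ℕ) : V.presheaf.stalk v) * (π.stalkMap v).hom (γ (X a)) := by
    rw [hab', hbγ, hgXd]
    simp only [map_add, map_mul, map_natCast]
  have hKl : ∀ l : Fin 40, (π.stalkMap v).hom (γ (K l)) =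
      (π.stalkMap v).hom (γ (X a)) ^ (exps12 l).1 * (π.stalkMap v).hom (γ (X b)) ^ (exps12 l).2.1 *
        (π.stalkMap v).hom (γ (X c)) ^ (exps12 l).2.2.1 *
        (π.stalkMap v).hom (γ (X d)) ^ (exps12 l).2.2.2 := by
    intro l
    rw [hK, gens12_eq_monomial]
    simp only [map_mul, map_pow]
  have hT0 : (π.stalkMap v).hom (γ (K j)) ≠ 0 := nonZeroDivisors.ne_zero hTnzd
  exact I12.chart_isPrincipal ((π.stalkMap v).hom (γ (X a))) ((π.stalkMap v).hom (γ (X b)))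
    ((π.stalkMap v).hom (γ (X c))) ((π.stalkMap v).hom (γ (X d))) ((π.stalkMap v).hom (γ (K j)))
    (m : V.presheaf.stalk v) ((m.choose 2 : ℕ) : V.presheaf.stalk v)
    ((m.choose 3 : ℕ) : V.presheaf.stalk v)
    (fun l => (π.stalkMap v).hom (γ (K l))) (fun l => χ (chartGen (fun l => γ (K l)) j l)) hKl
    aH.hom haXa haXb haXc haXd hT0 j rfl hrel hmem

/-- `I₁₂ ≠ 0` (it contains `x_d¹²`). [OURS · L1 W4.5c] -/
theorem I12_ne_bot (k : Type) [Field k] (n : ℕ) (a b c d : Fin n) : I12 k n a b c d ≠ ⊥ := by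
  intro h
  have h3 : gens12 k n a b c d 3 ∈ I12 k n a b c d := gens12_mem_I12 k n a b c d 3
  rw [h, Ideal.mem_bot] at h3
  exact pow_ne_zero 12 (X_ne_zero d) h3

/-- **Brick `HdivD` of the RUNG V5 scaffold** (binder `L/res-L1-w45c-lead-1/stubs/J5Bricks.lean`
l.72–86 VERBATIM, for any stability proof `hJ`): on `V = Bl_{I₁₂} 𝔸ⁿ` (`affineBlowup`) with the lifted
action of `⟨σ⟩` (`char k = p ≥ 5`), at every point `v` of the terminal chart `chart 3 = V[x_d¹²]`
fixed by the lift of `g`, the stalk augmentation ideal of `g` is principal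
(`I12.isPrincipal_stalkAug_liftAction_of_mem`, whose hypothesis `I₁₂ ⊆ (x_d)¹² · 𝒪_{V,v}` holds on
`V[x_d¹²]` by `BlowupExit.map_germ_mem_span_of_mem_blowupChart_spec`, p489049).
[OURS · L1 W4.5c] [folklore; assembly of landed decls] -/
theorem isPrincipal_stalkAug_liftAction_of_mem_chart_three (p : ℕ) (hp : p.Prime) (hp5 : 5 ≤ p)
    (k : Type) [Field k] [CharP k p] (n : ℕ)
    (σ : MvPolynomial (Fin n) k ≃ₐ[k] MvPolynomial (Fin n) k) (a b c d e : Fin n)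
    (hab : a ≠ b) (hac : a ≠ c) (had : a ≠ d) (hae : a ≠ e)
    (hb : σ (X b) = X b + X a) (hc : σ (X c) = X c + X b) (hd : σ (X d) = X d + X c)
    (he : σ (X e) = X e + X d)
    (hσ : ∀ i, i ≠ b → i ≠ c → i ≠ d → i ≠ e → σ (X i) = X i)
    (ρ : ↥(Subgroup.zpowers σ) →* Aut (Spec (CommRingCat.of (MvPolynomial (Fin n) k))))
    (hρ : ∀ g : ↥(Subgroup.zpowers σ), (ρ g).hom = Spec.map (CommRingCat.ofHom
      ((MulSemiringAction.toRingEquiv (↥(Subgroup.zpowers σ)) (MvPolynomial (Fin n) k) g⁻¹ :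
        MvPolynomial (Fin n) k ≃+* MvPolynomial (Fin n) k) :
          MvPolynomial (Fin n) k →+* MvPolynomial (Fin n) k)))
    (hJ : ∀ g : ↥(Subgroup.zpowers σ),
      (affineBlowup.idealSheaf (I12 k n a b c d)).comap (ρ g).hom =
        affineBlowup.idealSheaf (I12 k n a b c d))
    (g : ↥(Subgroup.zpowers σ)) (v : affineBlowup (I12 k n a b c d))
    (hv : (((affineBlowup.isBlowup (I12 k n a b c d)).liftAction ρ hJ) g).hom.base v = v)
    (hv3 : v ∈ chart k n a b c d 3) :
    (Ideal.span (Set.range fun s =>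
      ((affineBlowup (I12 k n a b c d)).presheaf.stalkSpecializes (specializes_of_eq hv) ≫
        (((affineBlowup.isBlowup (I12 k n a b c d)).liftAction ρ hJ) g).hom.stalkMap v).hom
          s - s)).IsPrincipal := by
  haveI : IsIntegral (affineBlowup (I12 k n a b c d)) :=
    affineBlowup.isIntegral (I12_ne_bot k n a b c d)
  -- the chart dictionary: on `V[x_d¹²]`, `I₁₂ ⊆ (x_d¹²) · 𝒪_{V,v}`
  have hmem : ∀ l : Fin 40, ((affineBlowup.π (I12 k n a b c d)).stalkMap v).hom
        (((Scheme.ΓSpecIso (CommRingCat.of (MvPolynomial (Fin n) k))).inv ≫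
          (Spec (CommRingCat.of (MvPolynomial (Fin n) k))).presheaf.germ ⊤
            ((affineBlowup.π (I12 k n a b c d)).base v) trivial).hom (gens12 k n a b c d l)) ∈
      Ideal.span {((affineBlowup.π (I12 k n a b c d)).stalkMap v).hom
        (((Scheme.ΓSpecIso (CommRingCat.of (MvPolynomial (Fin n) k))).inv ≫
          (Spec (CommRingCat.of (MvPolynomial (Fin n) k))).presheaf.germ ⊤
            ((affineBlowup.π (I12 k n a b c d)).base v) trivial).hom (X d)) ^ 12} := by
    intro l
    have hv3' : v ∈ blowupChart (affineBlowup.π (I12 k n a b c d))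
        (affineBlowup.idealSheaf (I12 k n a b c d)) ⟨⊤, isAffineOpen_top _⟩
        ((Scheme.ΓSpecIso (CommRingCat.of (MvPolynomial (Fin n) k))).inv.hom
          (gens12 k n a b c d 3)) := hv3
    have h := BlowupExit.map_germ_mem_span_of_mem_blowupChart_spec
      (affineBlowup.π (I12 k n a b c d)) (I12 k n a b c d) (gens12_mem_I12 k n a b c d l) hv3'
    have e3 : gens12 k n a b c d 3 = X d ^ 12 := rfl
    rw [e3, map_pow, map_pow] at h
    exact h
  exact I12.isPrincipal_stalkAug_liftAction_of_mem p hp hp5 k n σ a b c d e hab hac had hae hb hc hd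
    he hσ _ rfl ρ hρ (affineBlowup.isBlowup _) hJ g v hv hmem

end Summit.ResolutionOfSingularities.ResolutionOfSingularities.Theorems.WildQuotientResolution.JordanFive

end
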